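import Mathlib
import Literature.Analysis.FunctionSpaces.PlancherelL1L2
import Summits.NavierStokesRegularity.NavierStokesRegularity.Theorems.FilamentSkeletonRssClause13ModelSelfForm
import Summits.NavierStokesRegularity.NavierStokesRegularity.Theorems.FilamentSkeletonRssClause13LowSliceGain
import Summits.NavierStokesRegularity.NavierStokesRegularity.Theorems.FilamentSkeletonRssClause13SymbolDecay

/-!
# Clause 13-J, brick B4/B8: the LOW-SLICE GAIN of the model self form
# `(2/q)‖f‖² − ⟨K_q∗f, f⟩ ≤ −(2/q)·(a²/4)·log(1/a)·‖f‖²` for `f` Fourier-supported in the slice `a ≤ |z|√q ≤ 1/10`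

Route `FilamentSkeletonRss`, child `Clause13NearStraightL` (stmt-NavierStokesRegularity-23321; typing-agnostic, valid verbatim for the A1G
twin 28296); design of record `filament-plan/DESIGN-NOTE-28296-tenure-g22.md` §5 ("global L² estimate first … −𝔖(μD) on S0/S1 via
Plancherel … then per DYADIC sub-slice k ~ 2^j c₁/R of S0: gain_j ≈ (Γγ/4π) k_j² log(2/(μk_j))").  In the model units of bricks B2–B4
(`M_q = (2/q)·I − K_q∗`, spectral symbol `(2/q)𝔖(z√q)`, `modelSelfForm_eq_spectral`, p665821) this file proves the dyadic-slice
lower bound: if the un-normalised transform `F(z) = ∫ f(x)e^{izx}dx` of `f ∈ L¹ ∩ L²` vanishes off the LOW SLICE `a ≤ |z|√q ≤ 1/10`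
(`0 < a ≤ 1/10`), then

  `(1/2π) ∫ (2/q)𝔖(z√q)|F(z)|² dz ≤ (2/q)(a²/4)(log a) · ∫‖f‖²`     (`log a < 0`: a GAIN of size `(2/q)(a²/4)log(1/a)·‖f‖₂²`),

from the pointwise symbol bound `𝔖(x) ≤ (x²/4)log x` on `(0, 1/10]` (`liaSym_le_quarter_sq_mul_log`, p666078), the monotonicity of
`x² log x` on `(0, 1/10]` (elementary: `log y − log a ≤ (y−a)/a`, `log(1/10) < −1/2`), evenness of `𝔖`, Plancherel for `L¹ ∩ L²`
(tree `Literature.Analysis.FunctionSpaces.integral_norm_sq_fourierIntegral_eq`) and the dictionary `𝓕f(ξ) = F(−2πξ)`.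
Lane ns-filament-19175-p1 g14; `--supports stmt-NavierStokesRegularity-23321 --as helper`.
HONEST FRAMING: harmonic analysis of an explicit model operator attached to a HYPOTHETICAL filament skeleton on the NEGATIVE side of a
MODEL route; nothing here bears on Navier–Stokes regularity or blow-up.
-/

noncomputable section

open MeasureTheory Real Complex Filter Set
open scoped FourierTransform ComplexConjugate
open Summit.NavierStokesRegularity.NavierStokesRegularity.Theorems.AnalyticStripLiaSymbol (liaSym liaSym_neg liaSym_zero
  one_sub_liaSym_nonneg one_sub_liaSym_le_exp liaSym_le_quarter_sq_mul_log)

namespace Summit.NavierStokesRegularity.NavierStokesRegularity.Theorems.MatchedKernel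
set_option linter.dupNamespace false

/-! ## §1 Elementary: `x² log x` is decreasing on `(0, 1/10]`; the slice bound for the symbol -/

/-- `log(1/10) < −1/2`, i.e. `log 10 > 1/2` (from `exp 1 < 3`). [folklore] -/
theorem log_one_div_ten_lt : Real.log (1 / 10) < -(1 / 2) := by
  rw [one_div, Real.log_inv, neg_lt_neg_iff]
  have h3 : Real.exp (1 / 2) < 10 := by
    have h1 : Real.exp (1 / 2) ≤ Real.exp 1 := Real.exp_le_exp.2 (by norm_num)
    have h2 : Real.exp 1 < 3 := lt_trans Real.exp_one_lt_d9 (by norm_num)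
    linarith
  calc (1 / 2 : ℝ) = Real.log (Real.exp (1 / 2)) := (Real.log_exp _).symm
    _ < Real.log 10 := Real.log_lt_log (Real.exp_pos _) h3

/-- `y² log y ≤ a² log a` for `0 < a ≤ y ≤ 1/10` (the map `x ↦ x² log x` decreases on `(0, e^{-1/2}] ⊃ (0, 1/10]`). [folklore] -/
theorem sq_mul_log_antitone {a y : ℝ} (ha : 0 < a) (hay : a ≤ y) (hy : y ≤ 1 / 10) :
    y ^ 2 * Real.log y ≤ a ^ 2 * Real.log a := by
  have hy0 : 0 < y := lt_of_lt_of_le ha hay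
  -- `log y − log a ≤ (y − a)/a`
  have hlog : Real.log y - Real.log a ≤ (y - a) / a := by
    have h := Real.log_le_sub_one_of_pos (div_pos hy0 ha)
    rw [Real.log_div hy0.ne' ha.ne'] at h
    rw [div_sub_one ha.ne'] at h
    exact h
  -- `log y ≤ log(1/10) < −1/2`
  have hlogy : Real.log y ≤ -(1 / 2) :=
    le_of_lt (lt_of_le_of_lt (Real.log_le_log hy0 hy) log_one_div_ten_lt)
  -- `y² log y − a² log a = (y² − a²) log y + a² (log y − log a)`
  have hya : 0 ≤ y - a := by linarith
  have h1 : (y ^ 2 - a ^ 2) * Real.log y ≤ (y ^ 2 - a ^ 2) * (-(1 / 2)) :=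
    mul_le_mul_of_nonneg_left hlogy (by nlinarith)
  have h2 : a ^ 2 * (Real.log y - Real.log a) ≤ a ^ 2 * ((y - a) / a) :=
    mul_le_mul_of_nonneg_left hlog (by positivity)
  have h2' : a ^ 2 * ((y - a) / a) = a * (y - a) := by field_simp
  nlinarith [h1, h2, h2', mul_nonneg ha.le hya]

/-- **Slice bound for the symbol**: for `0 < a ≤ |x| ≤ 1/10`, `𝔖(x) ≤ (a²/4)·log a` (`< 0`). [folklore] -/
theorem liaSym_le_of_mem_lowSlice {a x : ℝ} (ha : 0 < a) (hax : a ≤ |x|) (hx : |x| ≤ 1 / 10) :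
    liaSym x ≤ a ^ 2 / 4 * Real.log a := by
  have hx0 : 0 < |x| := lt_of_lt_of_le ha hax
  have heven : liaSym x = liaSym |x| := by
    rcases le_or_gt 0 x with h | h
    · rw [abs_of_nonneg h]
    · rw [abs_of_neg h, liaSym_neg]
  rw [heven]
  calc liaSym |x| ≤ |x| ^ 2 / 4 * Real.log |x| := liaSym_le_quarter_sq_mul_log |x| hx0 hx
    _ = (|x| ^ 2 * Real.log |x|) / 4 := by ring
    _ ≤ (a ^ 2 * Real.log a) / 4 := by
        exact div_le_div_of_nonneg_right (sq_mul_log_antitone ha hax hx) (by norm_num)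
    _ = a ^ 2 / 4 * Real.log a := by ring

/-- `𝔖` is bounded: `|𝔖(x)| ≤ 4` (from `0 ≤ 1 − 𝔖 ≤ 5e^{−|x|/2}` and evenness). [folklore] -/
theorem abs_liaSym_le_four (x : ℝ) : |liaSym x| ≤ 4 := by
  have key : ∀ y : ℝ, 0 < y → |liaSym y| ≤ 4 := by
    intro y hy
    have h1 := one_sub_liaSym_nonneg y
    have h2 := one_sub_liaSym_le_exp y hy
    have h3 : Real.exp (-(y / 2)) ≤ 1 := Real.exp_le_one_iff.2 (by linarith)
    rw [abs_le]; constructor <;> linarith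
  rcases lt_trichotomy x 0 with h | h | h
  · rw [← liaSym_neg]; exact key (-x) (by linarith)
  · rw [h, liaSym_zero, abs_zero]; norm_num
  · exact key x h

/-! ## §2 The dictionary `𝓕f(ξ) = F(−2πξ)` and the integrability of `|F|²` for `f ∈ L¹ ∩ L²` -/

/-- `F(z) := ∫ f(x)e^{izx}dx = 𝓕f(−z/(2π))` (Mathlib's convention `𝓕f(ξ) = ∫ f(x)e^{−2πiξx}dx`). [folklore] -/
theorem unnormalisedTransform_eq_fourier (f : ℝ → ℂ) (z : ℝ) :
    ∫ x : ℝ, f x * cexp (I * z * x) = 𝓕 f (-z / (2 * π)) := by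
  rw [Real.fourier_real_eq_integral_exp_smul]
  refine integral_congr_ae (Eventually.of_forall fun x => ?_)
  dsimp only
  rw [smul_eq_mul, mul_comm (f x)]
  congr 1
  congr 1
  push_cast
  field_simp

/-- For `f ∈ L¹ ∩ L²`, `z ↦ |F(z)|²` is integrable. [folklore] -/
theorem integrable_norm_sq_unnormalisedTransform {f : ℝ → ℂ} (hf : Integrable f) (hf2 : MemLp f 2) :
    Integrable (fun z : ℝ => ‖∫ x : ℝ, f x * cexp (I * z * x)‖ ^ 2) := by
  have hF := Literature.Analysis.FunctionSpaces.memLp_two_fourierIntegral hf hf2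
  have hI : Integrable (fun ξ : ℝ => ‖𝓕 f ξ‖ ^ 2) := (memLp_two_iff_integrable_sq_norm hF.1).1 hF
  have hR : (-(1 / (2 * π)) : ℝ) ≠ 0 := by
    have : (0 : ℝ) < 1 / (2 * π) := by positivity
    linarith
  have h2 := hI.comp_mul_left' hR
  refine h2.congr (Eventually.of_forall fun z => ?_)
  dsimp only
  rw [unnormalisedTransform_eq_fourier]
  congr 3
  ring

/-! ## §3 The low-slice gain -/

/-- **LOW-SLICE GAIN (spectral side).**  If `F(z) = ∫ f(x)e^{izx}dx` (`f ∈ L¹ ∩ L²`) vanishes off the slice `a ≤ |z|√q ≤ 1/10`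
(`0 < a`, `q > 0`; the slice is empty unless `a ≤ 1/10`), then `(1/2π)∫(2/q)𝔖(z√q)|F(z)|²dz ≤ (2/q)(a²/4)(log a)·∫‖f‖²`. [folklore] -/
theorem spectralForm_le_of_lowSlice {q a : ℝ} (hq : 0 < q) (ha : 0 < a) {f : ℝ → ℂ}
    (hf : Integrable f) (hf2 : MemLp f 2)
    (hsupp : ∀ z : ℝ, (|z| * √q < a ∨ 1 / 10 < |z| * √q) → ∫ x : ℝ, f x * cexp (I * z * x) = 0) :
    1 / (2 * π) * ∫ z : ℝ, (2 / q * liaSym (z * √q)) * ‖∫ x : ℝ, f x * cexp (I * z * x)‖ ^ 2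
      ≤ 2 / q * (a ^ 2 / 4 * Real.log a) * ∫ t : ℝ, ‖f t‖ ^ 2 := by
  set F : ℝ → ℂ := fun z => ∫ x : ℝ, f x * cexp (I * z * x) with hFdef
  have hsq : 0 < √q := Real.sqrt_pos.2 hq
  -- pointwise: `(2/q)𝔖(z√q)|F z|² ≤ (2/q)(a²/4)(log a)|F z|²`
  have hpt : ∀ z : ℝ, (2 / q * liaSym (z * √q)) * ‖F z‖ ^ 2 ≤ (2 / q * (a ^ 2 / 4 * Real.log a)) * ‖F z‖ ^ 2 := by
    intro z
    by_cases hz : a ≤ |z| * √q ∧ |z| * √q ≤ 1 / 10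
    · have hx : a ≤ |z * √q| := by rw [abs_mul, abs_of_pos hsq]; exact hz.1
      have hx' : |z * √q| ≤ 1 / 10 := by rw [abs_mul, abs_of_pos hsq]; exact hz.2
      exact mul_le_mul_of_nonneg_right (mul_le_mul_of_nonneg_left (liaSym_le_of_mem_lowSlice ha hx hx') (by positivity))
        (by positivity)
    · have hF0 : F z = 0 := by
        refine hsupp z ?_
        rw [not_and_or, not_le, not_le] at hz
        exact hz
      simp [hF0]
  -- integrability of both sides
  have hI2 : Integrable (fun z : ℝ => ‖F z‖ ^ 2) := integrable_norm_sq_unnormalisedTransform hf hf2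
  have hIr : Integrable (fun z : ℝ => (2 / q * (a ^ 2 / 4 * Real.log a)) * ‖F z‖ ^ 2) := hI2.const_mul _
  have hIl : Integrable (fun z : ℝ => (2 / q * liaSym (z * √q)) * ‖F z‖ ^ 2) := by
    refine hI2.bdd_mul (c := 2 / q * 4) ?_ (Eventually.of_forall fun z => ?_)
    · exact ((continuous_const.mul (continuous_liaSym.comp (continuous_id.mul continuous_const))).aestronglyMeasurable)
    · rw [Real.norm_eq_abs, abs_mul, abs_of_pos (by positivity : (0:ℝ) < 2 / q)]
      exact mul_le_mul_of_nonneg_left (abs_liaSym_le_four _) (by positivity)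
  have hmono : ∫ z : ℝ, (2 / q * liaSym (z * √q)) * ‖F z‖ ^ 2 ≤ ∫ z : ℝ, (2 / q * (a ^ 2 / 4 * Real.log a)) * ‖F z‖ ^ 2 :=
    integral_mono hIl hIr hpt
  rw [integral_const_mul] at hmono
  -- Plancherel: `(1/2π)∫|F|² = ∫‖f‖²`
  have hplanch : 1 / (2 * π) * ∫ z : ℝ, ‖F z‖ ^ 2 = ∫ t : ℝ, ‖f t‖ ^ 2 := by
    rw [← Literature.Analysis.FunctionSpaces.integral_norm_sq_fourierIntegral_eq hf hf2,
      integral_norm_sq_fourier_eq_unnormalised]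
  have hpos : (0 : ℝ) < 1 / (2 * π) := by positivity
  calc 1 / (2 * π) * ∫ z : ℝ, (2 / q * liaSym (z * √q)) * ‖F z‖ ^ 2
      ≤ 1 / (2 * π) * ((2 / q * (a ^ 2 / 4 * Real.log a)) * ∫ z : ℝ, ‖F z‖ ^ 2) :=
        mul_le_mul_of_nonneg_left hmono hpos.le
    _ = 2 / q * (a ^ 2 / 4 * Real.log a) * (1 / (2 * π) * ∫ z : ℝ, ‖F z‖ ^ 2) := by ring
    _ = 2 / q * (a ^ 2 / 4 * Real.log a) * ∫ t : ℝ, ‖f t‖ ^ 2 := by rw [hplanch]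

/-- **LOW-SLICE GAIN for the model self operator `M_q = (2/q)·I − K_q∗`** (combine with `modelSelfForm_eq_spectral`):
for `f ∈ L¹ ∩ L²` whose un-normalised transform vanishes off `a ≤ |z|√q ≤ 1/10`,
`Re[(2/q)∫ conj f·f − ∫∫ K_q(t−u) f(u) conj f(t)] ≤ −(2/q)(a²/4) log(1/a) · ∫‖f‖²` — the form is NEGATIVE with a gain
`(2/q)(a²/4)log(1/a)` per unit `L²` mass (the note's `gain_j ≈ (Γγ/4π)k_j² log(2/(μk_j))` in model units). [folklore] -/
theorem modelSelfForm_re_le_of_lowSlice {q a : ℝ} (hq : 0 < q) (ha : 0 < a) {f : ℝ → ℂ}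
    (hf : Integrable f) (hf2 : MemLp f 2)
    (hsupp : ∀ z : ℝ, (|z| * √q < a ∨ 1 / 10 < |z| * √q) → ∫ x : ℝ, f x * cexp (I * z * x) = 0) :
    ((2 / q : ℂ) * (∫ t : ℝ, conj (f t) * f t)
      - ∫ t : ℝ, ∫ u : ℝ, ((((2 * q - (t - u) ^ 2) * (((t - u) ^ 2 + q) ^ (5 / 2 : ℝ))⁻¹ : ℝ)) : ℂ) * f u * conj (f t)).re
      ≤ -(2 / q * (a ^ 2 / 4) * Real.log (1 / a)) * ∫ t : ℝ, ‖f t‖ ^ 2 := by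
  rw [modelSelfForm_eq_spectral hq hf hf2, Complex.ofReal_re, one_div a, Real.log_inv]
  have h := spectralForm_le_of_lowSlice hq ha hf hf2 hsupp
  calc 1 / (2 * π) * ∫ z : ℝ, 2 / q * liaSym (z * √q) * ‖∫ x : ℝ, f x * cexp (I * ↑z * ↑x)‖ ^ 2
      ≤ 2 / q * (a ^ 2 / 4 * Real.log a) * ∫ t : ℝ, ‖f t‖ ^ 2 := h
    _ = -(2 / q * (a ^ 2 / 4) * -Real.log a) * ∫ t : ℝ, ‖f t‖ ^ 2 := by ring

end Summit.NavierStokesRegularity.NavierStokesRegularity.Theorems.MatchedKernel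

end
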